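import Literature.AnabelianGeometry.AbsoluteAnabelian.AbsTopII.InertiaGroupsScope
import Literature.AnabelianGeometry.AbsoluteAnabelian.AbsTopII.InertiaGroupsBranchScope
import Literature.AnabelianGeometry.AbsoluteAnabelian.AbsTopII.DecompositionGroupsMoreoverProofs
import Literature.AnabelianGeometry.AbsoluteAnabelian.AbsTopII.InertiaDecompositionProducts
import Literature.AnabelianGeometry.AbsoluteAnabelian.AbsTopII.Prop13vInertiaCentraliserReduction

/-!
# [AbsTopII] Prop 1.3 (iv), (viii): the «Moreover» equalities PROVED from their printed inputs

S. Mochizuki, *Topics in Absolute Anabelian Geometry II* [AbsTopII] (bib `MochizukiAbsTopII2013`;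
locators = PDF pages of the kurims manuscript `paper:url-585b8d0ad0d9`), §1, Def 1.2 (ii) p. 10,
Proposition 1.3 (ii)–(viii) pp. 11–12; proof of (iv) p. 13 (last two lines) – p. 14 l. 6, proof of
(viii) p. 16.

PROOF-ONLY companion (no definition) of the two typed «Moreover» predicates — the "CANDIDATE NEXT
ROWS (pure group theory, same method)" of the cell's sub-DAG `plan/L4/SUBDAG-AbsTopII-Prop13.md`:
abc-iut-L4-t6's `DPSCData.Prop13iv_moreover` (`AbsTopII/DecompositionGroupsMoreover.lean`, p431316:
(2) "`I_v ∩ I_{v′} = {1}`, [for appropriate choices of conjugates] `D_v ∩ D_{v′} ∩ Π_I = I_e`"; (3)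
"`Π_v ∩ Π_{v′} = I_v ∩ I_{v′} = I_v ∩ I_{v″} = I_{v′} ∩ I_{v″} = {1}`, [for appropriate choices of
conjugates] `D_v ∩ D_{v′} ∩ Π_I = I_{v″}`") and `DPSCIndexData.Prop_1_3_viii'`
(`AbsTopII/InertiaGroupsScope.lean`, p427207: "Moreover, in the situation of (2), [for appropriate
choices of conjugates] we have `I_v = D_e ∩ D_{e′} ∩ Π_I`").

WHAT IS PROVED (kernel), for abstract DPSC data `X` (abc-iut-L4-t4's `DPSCData`, REAL definitions
`D_v := N_{Π_H}(Π_v)`, `I_v := Z_{Π_I}(Π_v)`, `D_e := N_{Π_H}(Π_e)`, `I_e := Z_{Π_I}(Π_e)`):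

* §A `eq_of_le_of_inf_eq_bot_of_sup_eq` — the printed step shared by (iv)(3) p. 14 l. 5 and (viii)
  p. 16 l. 34, "`(Ẑ^Σ ≅) I_* ⊆ K ↪ I`, so `I_* = K`": `Z ≤ K ≤ M`, `K ∩ N = {1}`, `Z·N = M` ⇒ `K = Z`;
  at the DPSC data: `DPSCData.eq_conj_Iv_of_conj_Iv_le`.
* §B the SANDWICH of (iv)(2), p. 13 l. −2 – p. 14 l. 3: "`I_e = Π_e · I_v = Π_e · I_{v′} ⊆
  D_v ∩ D_{v′} ∩ Π_I ⊆ Z_{Π_I}(I_v × I_{v′}) ⊆ C_{Π_I}(I_e)`. On the other hand, by assertion (vii), we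
  have `C_{Π_I}(I_e) = I_e`. But this implies that `D_v ∩ D_{v′} ∩ Π_I = I_e`" —
  `DPSCData.conj_Dv_inf_conj_Dv_inf_PiI_eq_IvNode`, for the branch-configured `Π_𝔾`-conjugates.
* §C CLOSERS whose conclusions are LITERALLY the typed predicates:
  `DPSCData.prop13iv_moreover_of_inputs : … → X.Prop13iv_moreover`,
  `DPSCIndexData.prop13iv_moreover_of_prop_1_3 : … → X.Prop13iv_moreover` (inputs (ii)-clause-1,
  (iii), (iv)′, (v), (v)′, (vii) BY NAME as the typed predicates), and
  `DPSCIndexData.prop_1_3_viii'_of_inputs : … → X.Prop_1_3_viii'`.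

INPUTS that stay hypotheses (printed inputs of the printed proof, spelled in Mathlib terms over
`DPSCData`; no `def … : Prop` is declared; same class as rows I-surj / I-cuspconj of the sub-DAG):
`hbranch` — the BRANCH CONFIGURATION at a node `e` joining `v ≠ v′` (p. 13 l. −2 "it follows from
assertions (ii), (iii) [and the definitions]"; Prop 1.3 (ii) p. 11 "[for appropriate choices of
conjugates] … `I_v, I_{v′} ⊆ I_e`, and … `I_v × I_{v′} → I_e` is an open injective homomorphism";
Def 1.2 (ii) p. 10 for `Π_e ⊆ Π_v, Π_{v′}`), in the conjugacy convention of `DPSCIndexData.Prop_1_3_ii'`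
(node fixed, both branches `Π_𝔾`-conjugated); `hclaim` — the CLAIM of p. 14 l. 20–33 "`Π_v ∩ Π_{v′} =
{1}`" for distinct non-adjacent `v, v′` (log admissible coverings: GEOMETRIC); for (viii) the DICHOTOMY
(1)/(2) itself (pp. 16–19: GEOMETRIC), carrying print's "by assertions (ii), (iii), [for appropriate
choices of conjugates] `(Ẑ^Σ ≅) I_v ⊆ D_e ∩ D_{e′} ∩ Π_I`" as an inclusion of a `Π_𝔾`-conjugate of `I_v`
UNDER the same `∃ v` (not for every common vertex of `e, e′`: for two nodes joining `v` and `w` the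
non-trivial intersection sits at ONE of them); `I_v · Π_𝔾 = Π_I` (row I-surj).  The situation-(3)
inclusion "`(Ẑ^Σ ≅) I_{v″} ⊆ D_v ∩ D_{v′} ∩ Π_I`" (p. 14 l. 4–5) is NOT an input: it is DERIVED from two
instances of the (2)-sandwich along the path `v – v″ – v′`.
HONEST FRAMING: classical group theory applied to a refereed paper; the geometric inputs stay
hypotheses (typed ≠ proved); nothing here bears on [IUTchIII] Cor 3.12 (abc-iut f-069 gen 3).
-/

open scoped Pointwise

namespace Literature.AnabelianGeometry.AbsoluteAnabelian

universe u

/-! ## §A. Generic group theory -/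
section GroupTheory

variable {G : Type u} [Group G]

/-- **The printed step "`(Ẑ^Σ ≅) I_* ⊆ K ↪ I`, so `I_* = K`"** ((iv) p. 14 l. 5, (viii) p. 16 l. 34),
abstractly: if `Z ≤ K ≤ M`, `K ∩ N = {1}` (`K ↪ M/N`) and `Z · N = M` (`Z ↠ M/N`), `N` normal, then
`K = Z` (Dedekind's modular law). [cite: MochizukiAbsTopII2013, Prop 1.3 (viii) proof p.16] -/
theorem eq_of_le_of_inf_eq_bot_of_sup_eq {Z K M N : Subgroup G} [N.Normal]
    (hZK : Z ≤ K) (hKM : K ≤ M) (hKN : K ⊓ N = ⊥) (hZN : Z ⊔ N = M) : K = Z := by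
  refine le_antisymm (fun k hk => ?_) hZK
  have hkM : k ∈ Z ⊔ N := by rw [hZN]; exact hKM hk
  rw [Subgroup.mem_sup_of_normal_right] at hkM
  obtain ⟨z, hz, n, hn, rfl⟩ := hkM
  have hnK : n ∈ K := by
    have := K.mul_mem (K.inv_mem (hZK hz)) hk
    rwa [inv_mul_cancel_left] at this
  have hn1 : n = 1 := by
    rw [← Subgroup.mem_bot, ← hKN]
    exact ⟨hnK, hn⟩
  rw [hn1, mul_one]
  exact hz

/-- `g·Z_G(K)·g⁻¹ = Z_G(g·K·g⁻¹)` (twin of the private transport lemmas of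
`AbsTopII/Prop13ConjugacyScope.lean`). [folklore] -/
private theorem conj_smul_centralizer' (g : G) (K : Subgroup G) :
    MulAut.conj g • Subgroup.centralizer (K : Set G) =
      Subgroup.centralizer ((MulAut.conj g • K : Subgroup G) : Set G) := by
  ext x
  rw [Subgroup.mem_pointwise_smul_iff_inv_smul_mem, Subgroup.mem_centralizer_iff,
    Subgroup.mem_centralizer_iff]
  constructor
  · intro h m hm
    rw [SetLike.mem_coe, Subgroup.mem_pointwise_smul_iff_inv_smul_mem] at hm
    have e := h _ hm
    rw [← smul_mul', ← smul_mul'] at e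
    exact MulAction.injective _ e
  · intro h k hk
    have e := h (MulAut.conj g • k) (Subgroup.smul_mem_pointwise_smul _ _ _ hk)
    apply MulAction.injective (MulAut.conj g)
    simp only [smul_mul', smul_inv_smul]
    exact e

/-- From `a·A·a⁻¹ ⊆ b·B·b⁻¹` to `(b⁻¹a)·A·(b⁻¹a)⁻¹ ⊆ B`. [folklore] -/
private theorem conj_le_of_conj_le_conj {A B : Subgroup G} {a b : G}
    (h : MulAut.conj a • A ≤ MulAut.conj b • B) : MulAut.conj (b⁻¹ * a) • A ≤ B := by
  rw [map_mul, mul_smul, map_inv]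
  exact Subgroup.subset_pointwise_smul_iff.mp h

/-- From `d·A·d⁻¹ ⊆ B` to `c·A·c⁻¹ ⊆ (cd⁻¹)·B·(cd⁻¹)⁻¹`. [folklore] -/
private theorem conj_le_conj_of_conj_le {A B : Subgroup G} {d : G} (c : G)
    (h : MulAut.conj d • A ≤ B) : MulAut.conj c • A ≤ MulAut.conj (c * d⁻¹) • B := by
  have hc : MulAut.conj c • A = MulAut.conj (c * d⁻¹) • (MulAut.conj d • A) := by
    rw [smul_smul, ← map_mul, mul_assoc, inv_mul_cancel, mul_one]
  rw [hc]
  exact Subgroup.pointwise_smul_le_pointwise_smul_iff.mpr h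

end GroupTheory

/-! ## §B. At the DPSC data of [AbsTopII] Def 1.2 (ii) -/
namespace DPSCData

variable (X : DPSCData.{u})

/-- `I_v = Z_{Π_I}(Π_v) ⊆ N_{Π_H}(Π_v) = D_v` (Def 1.2 (ii)). [cite: MochizukiAbsTopII2013, Def 1.2 (ii) p.10] -/
theorem Iv_le_Dv (v : X.Vert) : X.Iv v ≤ X.Dv v :=
  le_trans inf_le_left (Subgroup.centralizer_le_normalizer _)

/-- A conjugate `h·I_v·h⁻¹` still surjects onto `I = Π_I/Π_𝔾`: `h·I_v·h⁻¹ · Π_𝔾 = Π_I` (`Π_𝔾`, `Π_I`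
normal in `Π_H`; row I-surj of the sub-DAG, (iii) proof p. 13 "this injection is, in fact,
surjective"). [cite: MochizukiAbsTopII2013, Prop 1.3 (iii) proof p.13] -/
theorem conj_Iv_sup_PiG_eq_PiI {v : X.Vert} (hsurj : X.Iv v ⊔ X.PiG = X.PiI) (h : X.PiH) :
    MulAut.conj h • X.Iv v ⊔ X.PiG = X.PiI := by
  haveI : X.PiG.Normal := X.normal_PiG
  haveI : X.PiI.Normal := X.normal_PiI
  rw [← Subgroup.Normal.conj_smul_eq_self h X.PiG, ← Subgroup.smul_sup, hsurj,
    Subgroup.Normal.conj_smul_eq_self]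

/-- **"`(Ẑ^Σ ≅) I_* ⊆ K ↪ I`, so `I_* = K`" at the DPSC data** ((iv) p. 14 l. 5 with `I_* = I_{v″}`,
`K = D_v ∩ D_{v′} ∩ Π_I`; (viii) p. 16 l. 34 with `I_* = I_v`, `K = D_e ∩ D_{e′} ∩ Π_I`): a subgroup
`K ⊆ Π_I` meeting `Π_𝔾` trivially and containing a conjugate `h·I_v·h⁻¹` of an inertia group that
surjects onto `I` IS that conjugate. [cite: MochizukiAbsTopII2013, Prop 1.3 (viii) proof p.16] -/
theorem eq_conj_Iv_of_conj_Iv_le {v : X.Vert} {h : X.PiH} {K : Subgroup X.PiH}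
    (hsurj : X.Iv v ⊔ X.PiG = X.PiI) (hle : MulAut.conj h • X.Iv v ≤ K) (hKI : K ≤ X.PiI)
    (hKG : K ⊓ X.PiG = ⊥) : K = MulAut.conj h • X.Iv v :=
  haveI : X.PiG.Normal := X.normal_PiG
  eq_of_le_of_inf_eq_bot_of_sup_eq hle hKI hKG (X.conj_Iv_sup_PiG_eq_PiI hsurj h)

/-! ### The sandwich of (iv), situation (2) (p. 13 l. −2 – p. 14 l. 3) -/

/-- **"`I_e = Π_e · I_v`"** (p. 13 last line), for a branch conjugate `γ·I_v·γ⁻¹ ⊆ I_e`: from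
`I_e ∩ Π_𝔾 = Π_e` ((ii): kernel of `I_e → I`) and `I_v ↠ I`, by the modular law.
[cite: MochizukiAbsTopII2013, Prop 1.3 (iv) proof p.13] -/
theorem IvNode_eq_conj_Iv_sup_nodeSub {e : X.Node} {v : X.Vert} {γ : X.PiH}
    (hsurj : X.Iv v ⊔ X.PiG = X.PiI) (hIv : MulAut.conj γ • X.Iv v ≤ X.IvNode e)
    (hEG : X.IvNode e ⊓ X.PiG = X.nodeSub e) :
    X.IvNode e = MulAut.conj γ • X.Iv v ⊔ X.nodeSub e := by
  haveI : X.PiG.Normal := X.normal_PiG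
  have h := inf_eq_sup_of_sup_eq (X.conj_Iv_sup_PiG_eq_PiI hsurj γ) hIv hEG X.PiG_le_PiI
  have hle : X.IvNode e ≤ X.PiI := inf_le_right
  rwa [inf_eq_left.mpr hle] at h

/-- **"`I_e = Π_e · I_v ⊆ D_v`"** (p. 13 l. −1 – p. 14 l. 1), for the branch conjugates: `Π_e ⊆ γΠ_vγ⁻¹
⊆ γD_vγ⁻¹` and `γI_vγ⁻¹ ⊆ γD_vγ⁻¹` (`I_v ⊆ D_v`). [cite: MochizukiAbsTopII2013, Prop 1.3 (iv) proof p.14] -/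
theorem IvNode_le_conj_Dv {e : X.Node} {v : X.Vert} {γ : X.PiH}
    (hsurj : X.Iv v ⊔ X.PiG = X.PiI) (hIv : MulAut.conj γ • X.Iv v ≤ X.IvNode e)
    (hEG : X.IvNode e ⊓ X.PiG = X.nodeSub e) (hPv : X.nodeSub e ≤ MulAut.conj γ • X.vertSub v) :
    X.IvNode e ≤ MulAut.conj γ • X.Dv v := by
  rw [X.IvNode_eq_conj_Iv_sup_nodeSub hsurj hIv hEG]
  refine sup_le (Subgroup.pointwise_smul_le_pointwise_smul_iff.mpr (X.Iv_le_Dv v)) ?_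
  exact le_trans hPv (Subgroup.pointwise_smul_le_pointwise_smul_iff.mpr Subgroup.le_normalizer)

/-- Transport of the (v)-input "`D_v ∩ Π_I ⊆ Z_{Π_I}(I_v)`" ((iii)/(v): `D_v ∩ Π_I = I_v × Π_v ⊆
Z_{Π_I}(I_v)`, p. 16) to a conjugate vertex: `γD_vγ⁻¹ ∩ Π_I ⊆ Z(γI_vγ⁻¹)`.
[cite: MochizukiAbsTopII2013, Prop 1.3 (v) proof p.16] -/
theorem conj_Dv_inf_PiI_le_centralizer {v : X.Vert} (γ : X.PiH)
    (hZ : X.Dv v ⊓ X.PiI ≤ Subgroup.centralizer (X.Iv v : Set X.PiH)) :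
    MulAut.conj γ • X.Dv v ⊓ X.PiI ≤
      Subgroup.centralizer ((MulAut.conj γ • X.Iv v : Subgroup X.PiH) : Set X.PiH) := by
  haveI : X.PiI.Normal := X.normal_PiI
  have h : MulAut.conj γ • (X.Dv v ⊓ X.PiI) ≤ MulAut.conj γ • Subgroup.centralizer (X.Iv v : Set X.PiH) :=
    Subgroup.pointwise_smul_le_pointwise_smul_iff.mpr hZ
  rwa [Subgroup.smul_inf, Subgroup.Normal.conj_smul_eq_self γ X.PiI, conj_smul_centralizer'] at h

/-- **The sandwich of (iv), situation (2)** (p. 13 l. −2 – p. 14 l. 3): "`I_e = Π_e · I_v = Π_e · I_{v′}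
⊆ D_v ∩ D_{v′} ∩ Π_I ⊆ Z_{Π_I}(I_v × I_{v′}) ⊆ C_{Π_I}(I_e)`. On the other hand, by assertion (vii), we
have `C_{Π_I}(I_e) = I_e`. But this implies that `D_v ∩ D_{v′} ∩ Π_I = I_e`" — PROVED for the branch
conjugates `γ, γ′` at the node `e` (the node fixed, the two branch vertices conjugated: the convention of
`DPSCIndexData.Prop_1_3_ii'`).  Inputs: the branch configuration (`Π_e ⊆ γΠ_vγ⁻¹, γ′Π_{v′}γ′⁻¹`;
`γI_vγ⁻¹, γ′I_{v′}γ′⁻¹ ⊆ I_e` of finite index jointly — Prop 1.3 (ii)); `I_e ∩ Π_𝔾 = Π_e` ((ii));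
`I_v ↠ I` ((iii)); `D_v ∩ Π_I ⊆ Z_{Π_I}(I_v)` ((iii)/(v)); `C_{Π_I}(Π_e) ⊆ I_e` ((vii):
`D_e = C_{Π_H}(Π_e)`, `I_e = D_e ∩ Π_I`).  The step "`Z_{Π_I}(I_v × I_{v′}) ⊆ C_{Π_I}(I_e)`" is: an
element centralising both branch inertia groups normalises their join `J`, of finite index in `I_e`,
hence commensurates `J ~ I_e`; and `C(I_e) ⊆ C(I_e ∩ Π_𝔾) = C(Π_e)`.
[cite: MochizukiAbsTopII2013, Prop 1.3 (iv) proof p.14] -/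
theorem conj_Dv_inf_conj_Dv_inf_PiI_eq_IvNode {e : X.Node} {v v' : X.Vert} {γ γ' : X.PiH}
    (hPv : X.nodeSub e ≤ MulAut.conj γ • X.vertSub v)
    (hPv' : X.nodeSub e ≤ MulAut.conj γ' • X.vertSub v')
    (hIv : MulAut.conj γ • X.Iv v ≤ X.IvNode e) (hIv' : MulAut.conj γ' • X.Iv v' ≤ X.IvNode e)
    (hfin : (MulAut.conj γ • X.Iv v ⊔ MulAut.conj γ' • X.Iv v').relIndex (X.IvNode e) ≠ 0)
    (hEG : X.IvNode e ⊓ X.PiG = X.nodeSub e)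
    (hsurj : ∀ w : X.Vert, X.Iv w ⊔ X.PiG = X.PiI)
    (hZ : ∀ w : X.Vert, X.Dv w ⊓ X.PiI ≤ Subgroup.centralizer (X.Iv w : Set X.PiH))
    (hC : Subgroup.Commensurable.commensurator (X.nodeSub e) ⊓ X.PiI ≤ X.IvNode e) :
    MulAut.conj γ • X.Dv v ⊓ MulAut.conj γ' • X.Dv v' ⊓ X.PiI = X.IvNode e := by
  haveI : X.PiG.Normal := X.normal_PiG
  set J := MulAut.conj γ • X.Iv v ⊔ MulAut.conj γ' • X.Iv v' with hJ
  have hJE : J ≤ X.IvNode e := sup_le hIv hIv'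
  apply le_antisymm
  · -- `D_v ∩ D_{v′} ∩ Π_I ⊆ Z_{Π_I}(I_v × I_{v′}) ⊆ C_{Π_I}(I_e) = I_e`
    rintro x ⟨⟨hxD, hxD'⟩, hxI⟩
    have hx1 : x ∈ Subgroup.centralizer ((MulAut.conj γ • X.Iv v : Subgroup X.PiH) : Set X.PiH) :=
      X.conj_Dv_inf_PiI_le_centralizer γ (hZ v) ⟨hxD, hxI⟩
    have hx2 : x ∈ Subgroup.centralizer ((MulAut.conj γ' • X.Iv v' : Subgroup X.PiH) : Set X.PiH) :=
      X.conj_Dv_inf_PiI_le_centralizer γ' (hZ v') ⟨hxD', hxI⟩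
    -- `x` normalises the join `J = γI_vγ⁻¹ · γ′I_{v′}γ′⁻¹`
    have hxN : x ∈ Subgroup.normalizer (J : Set X.PiH) :=
      Subgroup.normalizer_inf_normalizer_le_normalizer_sup _ _
        ⟨Subgroup.centralizer_le_normalizer _ hx1, Subgroup.centralizer_le_normalizer _ hx2⟩
    -- hence commensurates `J ~ I_e`
    have hJcomm : Subgroup.Commensurable J (X.IvNode e) :=
      ⟨hfin, by rw [Subgroup.relIndex_eq_one.mpr hJE]; exact one_ne_zero⟩
    have hxC : x ∈ Subgroup.Commensurable.commensurator (X.IvNode e) := by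
      rw [← Subgroup.Commensurable.eq hJcomm, Subgroup.Commensurable.commensurator_mem_iff,
        Subgroup.conjAct_pointwise_smul_eq_self hxN]
    -- `C(I_e) ⊆ C(I_e ∩ Π_𝔾) = C(Π_e)`, and `C_{Π_I}(Π_e) ⊆ I_e` by (vii)
    have hxC' : x ∈ Subgroup.Commensurable.commensurator (X.nodeSub e) := by
      rw [← hEG]
      exact commensurator_le_commensurator_inf_normal _ _ hxC
    exact hC ⟨hxC', hxI⟩
  · -- `I_e = Π_e · I_v = Π_e · I_{v′} ⊆ D_v ∩ D_{v′} ∩ Π_I`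
    exact le_inf (le_inf (X.IvNode_le_conj_Dv (hsurj v) hIv hEG hPv)
      (X.IvNode_le_conj_Dv (hsurj v') hIv' hEG hPv')) inf_le_right

/-- **Situation (2) of (iv) AS TYPED** (the first conjunct of `Prop13iv_moreover` at `v ≠ v′`, `e`):
from the branch configuration at `e` and the inputs of the sandwich, produce the `Π_𝔾`-conjugates
`δ = γ⁻¹γ′` of `v′` and `ε = γ⁻¹` of `e` with `I_v ∩ δI_{v′}δ⁻¹ = {1}` ("In particular" clause of
(iv)′, `v ≠ v′`) and `D_v ∩ δD_{v′}δ⁻¹ ∩ Π_I = εI_eε⁻¹` (the sandwich, conjugated back by `γ⁻¹`).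
[cite: MochizukiAbsTopII2013, Prop 1.3 (iv) p.12] -/
theorem prop13iv_moreover_two (hiv : X.Prop13iv') {e : X.Node} {v v' : X.Vert} (hne : v ≠ v')
    {γ γ' : X.PiH} (hγ : γ ∈ X.PiG) (hγ' : γ' ∈ X.PiG)
    (hPv : X.nodeSub e ≤ MulAut.conj γ • X.vertSub v)
    (hPv' : X.nodeSub e ≤ MulAut.conj γ' • X.vertSub v')
    (hIv : MulAut.conj γ • X.Iv v ≤ X.IvNode e) (hIv' : MulAut.conj γ' • X.Iv v' ≤ X.IvNode e)
    (hfin : (MulAut.conj γ • X.Iv v ⊔ MulAut.conj γ' • X.Iv v').relIndex (X.IvNode e) ≠ 0)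
    (hEG : X.IvNode e ⊓ X.PiG = X.nodeSub e)
    (hsurj : ∀ w : X.Vert, X.Iv w ⊔ X.PiG = X.PiI)
    (hZ : ∀ w : X.Vert, X.Dv w ⊓ X.PiI ≤ Subgroup.centralizer (X.Iv w : Set X.PiH))
    (hC : Subgroup.Commensurable.commensurator (X.nodeSub e) ⊓ X.PiI ≤ X.IvNode e) :
    ∃ δ : X.PiH, δ ∈ X.PiG ∧ X.Iv v ⊓ MulAut.conj δ • X.Iv v' = ⊥ ∧
      ∃ ε : X.PiH, ε ∈ X.PiG ∧
        X.Dv v ⊓ MulAut.conj δ • X.Dv v' ⊓ X.PiI = MulAut.conj ε • X.IvNode e := by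
  haveI : X.PiI.Normal := X.normal_PiI
  have hE := X.conj_Dv_inf_conj_Dv_inf_PiI_eq_IvNode hPv hPv' hIv hIv' hfin hEG hsurj hZ hC
  refine ⟨γ⁻¹ * γ', X.PiG.mul_mem (X.PiG.inv_mem hγ) hγ',
    X.Iv_inf_conj_Iv_eq_bot_of_ne hiv hne (X.PiG.mul_mem (X.PiG.inv_mem hγ) hγ'),
    γ⁻¹, X.PiG.inv_mem hγ, ?_⟩
  have h := congrArg (fun S : Subgroup X.PiH => MulAut.conj γ⁻¹ • S) hE
  simp only [Subgroup.smul_inf, smul_smul, ← map_mul, inv_mul_cancel, map_one, one_smul,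
    Subgroup.Normal.conj_smul_eq_self] at h
  exact h

/-- **[AbsTopII] Prop 1.3 (iv), the «Moreover» clauses AS TYPED** (`DPSCData.Prop13iv_moreover`,
abc-iut-L4-t6 p431316) **from their printed inputs**.  PROVED (group theory): the situation-(2)
equality `D_v ∩ δD_{v′}δ⁻¹ ∩ Π_I = εI_eε⁻¹` (the sandwich `conj_Dv_inf_conj_Dv_inf_PiI_eq_IvNode`); the
situation-(3) inclusion "`(Ẑ^Σ ≅) I_{v″} ⊆ D_v ∩ D_{v′} ∩ Π_I`" (p. 14 l. 4–5: from TWO (2)-sandwiches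
along `v – v″ – v′`, `I_{e₁} ⊆ βD_vβ⁻¹` and `I_{e₂} ⊆ β′D_{v′}β′⁻¹`) and the equality "`so I_{v″} =
D_v ∩ D_{v′} ∩ Π_I`" (`eq_conj_Iv_of_conj_Iv_le`, the `Π_𝔾`-part vanishing by "`D_v ∩ D_{v′} ∩ Π_𝔾 =
Π_v ∩ Π_{v′} = {1}`"); the four "`= {1}`" of (3) from the "In particular" clause of (iv)′ and the
CLAIM.  HYPOTHESES (printed inputs, verbatim): `hiv` = (iv)′ (its "In particular" clause is used);
`hbranch` = the branch configuration of Prop 1.3 (ii) + Def 1.2 (ii) at each node joining `v ≠ v′`;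
`hEG` = "`I_e ∩ Π_𝔾 = Π_e`" ((ii)); `hsurj` = "`I_v ↠ I`" ((iii)); `hZ` = "`D_v ∩ Π_I ⊆ Z_{Π_I}(I_v)`"
((iii)/(v)); `hC` = "`C_{Π_I}(Π_e) ⊆ I_e`" ((vii)); `hDG` = "`D_v ∩ Π_𝔾 = Π_v`" ((v), [CombGC] Prop 1.2
(ii)); `hclaim` = the CLAIM of p. 14 "`Π_v ∩ Π_{v′} = {1}`" for distinct non-adjacent vertices (log
admissible coverings — geometric).  Typed ≠ proved for the inputs.
[cite: MochizukiAbsTopII2013, Prop 1.3 (iv) p.12] -/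
theorem prop13iv_moreover_of_inputs (hiv : X.Prop13iv')
    (hbranch : ∀ (v v' : X.Vert) (e : X.Node), v ≠ v' → X.nodeAbuts e v → X.nodeAbuts e v' →
      ∃ γ γ' : X.PiH, γ ∈ X.PiG ∧ γ' ∈ X.PiG ∧
        X.nodeSub e ≤ MulAut.conj γ • X.vertSub v ∧ X.nodeSub e ≤ MulAut.conj γ' • X.vertSub v' ∧
        MulAut.conj γ • X.Iv v ≤ X.IvNode e ∧ MulAut.conj γ' • X.Iv v' ≤ X.IvNode e ∧
        (MulAut.conj γ • X.Iv v ⊔ MulAut.conj γ' • X.Iv v').relIndex (X.IvNode e) ≠ 0)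
    (hEG : ∀ e : X.Node, X.IvNode e ⊓ X.PiG = X.nodeSub e)
    (hsurj : ∀ v : X.Vert, X.Iv v ⊔ X.PiG = X.PiI)
    (hZ : ∀ v : X.Vert, X.Dv v ⊓ X.PiI ≤ Subgroup.centralizer (X.Iv v : Set X.PiH))
    (hC : ∀ e : X.Node, Subgroup.Commensurable.commensurator (X.nodeSub e) ⊓ X.PiI ≤ X.IvNode e)
    (hDG : ∀ v : X.Vert, X.Dv v ⊓ X.PiG = X.vertSub v)
    (hclaim : ∀ (v v' : X.Vert) (γ : X.PiH), v ≠ v' → ¬ X.Adjacent v v' → γ ∈ X.PiG →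
      X.vertSub v ⊓ MulAut.conj γ • X.vertSub v' = ⊥) :
    Literature.AnabelianGeometry.AbsoluteAnabelian.DPSCData.Prop13iv_moreover X := by
  haveI : X.PiG.Normal := X.normal_PiG
  haveI : X.PiI.Normal := X.normal_PiI
  refine ⟨fun v v' e hne hv hv' => ?_, fun v v' v'' hne hnadj hv''v hv''v' hadj hadj' => ⟨?_, ?_⟩⟩
  · obtain ⟨γ, γ', hγ, hγ', hPv, hPv', hIv, hIv', hfin⟩ := hbranch v v' e hne hv hv'
    exact X.prop13iv_moreover_two hiv hne hγ hγ' hPv hPv' hIv hIv' hfin (hEG e) hsurj hZ (hC e)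
  · intro γ hγ
    exact ⟨hclaim v v' γ hne hnadj hγ, X.Iv_inf_conj_Iv_eq_bot_of_ne hiv hne hγ,
      X.Iv_inf_conj_Iv_eq_bot_of_ne hiv (Ne.symm hv''v) hγ,
      X.Iv_inf_conj_Iv_eq_bot_of_ne hiv (Ne.symm hv''v') hγ⟩
  · -- situation (3): the path `v – e₁ – v″ – e₂ – v′`
    obtain ⟨e₁, he₁v, he₁v''⟩ := hadj
    obtain ⟨e₂, he₂v'', he₂v'⟩ := hadj'
    obtain ⟨α, β, hα, hβ, -, hP₁, hI₁, hI₁', -⟩ := hbranch v'' v e₁ hv''v he₁v'' he₁v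
    obtain ⟨α', β', hα', hβ', -, hP₂, hI₂, hI₂', -⟩ := hbranch v'' v' e₂ hv''v' he₂v'' he₂v'
    -- "(Ẑ^Σ ≅) I_{v″} ⊆ D_v ∩ D_{v′} ∩ Π_I": αI_{v″}α⁻¹ ⊆ I_{e₁} ⊆ βD_vβ⁻¹, α′I_{v″}α′⁻¹ ⊆ I_{e₂} ⊆ β′D_{v′}β′⁻¹
    have h₁ : MulAut.conj (β⁻¹ * α) • X.Iv v'' ≤ X.Dv v :=
      conj_le_of_conj_le_conj (le_trans hI₁ (X.IvNode_le_conj_Dv (hsurj v) hI₁' (hEG e₁) hP₁))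
    have h₂ : MulAut.conj (β'⁻¹ * α') • X.Iv v'' ≤ X.Dv v' :=
      conj_le_of_conj_le_conj (le_trans hI₂ (X.IvNode_le_conj_Dv (hsurj v') hI₂' (hEG e₂) hP₂))
    have hc₁ : β⁻¹ * α ∈ X.PiG := X.PiG.mul_mem (X.PiG.inv_mem hβ) hα
    have hc₂ : β'⁻¹ * α' ∈ X.PiG := X.PiG.mul_mem (X.PiG.inv_mem hβ') hα'
    have hγG : β⁻¹ * α * (β'⁻¹ * α')⁻¹ ∈ X.PiG := X.PiG.mul_mem hc₁ (X.PiG.inv_mem hc₂)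
    refine ⟨β⁻¹ * α * (β'⁻¹ * α')⁻¹, hγG, β⁻¹ * α, hc₁, ?_⟩
    refine X.eq_conj_Iv_of_conj_Iv_le (hsurj v'') (le_inf (le_inf h₁ (conj_le_conj_of_conj_le _ h₂)) ?_)
      inf_le_right ?_
    · -- `(β⁻¹α)·I_{v″}·(β⁻¹α)⁻¹ ⊆ Π_I`
      rw [← Subgroup.Normal.conj_smul_eq_self (β⁻¹ * α) X.PiI]
      exact Subgroup.pointwise_smul_le_pointwise_smul_iff.mpr inf_le_right
    · -- "`D_v ∩ D_{v′} ∩ Π_𝔾 = Π_v ∩ Π_{v′} = {1}`"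
      rw [eq_bot_iff, ← hclaim v v' _ hne hnadj hγG, ← hDG v, ← hDG v', Subgroup.smul_inf,
        Subgroup.Normal.conj_smul_eq_self _ X.PiG]
      rintro x ⟨⟨⟨hxD, hxD'⟩, -⟩, hxG⟩
      exact ⟨⟨hxD, hxG⟩, hxD', hxG⟩

end DPSCData

/-! ## §C. Closers at `DPSCIndexData` -/
namespace AbsTopII.DPSCIndexData

variable (X : DPSCIndexData.{u})

/-- **[AbsTopII] Prop 1.3 (iv), «Moreover» clauses, from the TYPED (ii), (iii), (iv)′, (v), (v)′, (vii)**
BY NAME (`DPSCIndexData.Prop_1_3_ii'` clause 1 "`I_e ∩ Π_𝔾 = Π_e`"; `DPSCData.Prop13iii` "`I_v · Π_𝔾 =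
Π_I`"; `DPSCData.Prop13iv'` "In particular"; `DPSCData.Prop13v` "`D_v ∩ Π_𝔾 = Π_v`";
`DPSCIndexData.Prop_1_3_v'` "`D_v ∩ Π_I = Z_{Π_I}(I_v)`"; `DPSCData.Prop13vii` "`D_e = C_{Π_H}(Π_e)`,
`I_e = D_e ∩ Π_I`") plus the two inputs that are NOT typed predicates: the branch configuration of (ii) /
Def 1.2 (ii) at each node (`hbranch`) and the CLAIM of p. 14 (`hclaim`, geometric).
[cite: MochizukiAbsTopII2013, Prop 1.3 (iv) p.12] -/
theorem prop13iv_moreover_of_prop_1_3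
    (hii : X.Prop_1_3_ii') (hiii : X.Prop13iii) (hiv : X.Prop13iv') (hv : X.Prop13v)
    (hv' : X.Prop_1_3_v') (hvii : X.Prop13vii)
    (hbranch : ∀ (v v' : X.Vert) (e : X.Node), v ≠ v' → X.nodeAbuts e v → X.nodeAbuts e v' →
      ∃ γ γ' : X.PiH, γ ∈ X.PiG ∧ γ' ∈ X.PiG ∧
        X.nodeSub e ≤ MulAut.conj γ • X.vertSub v ∧ X.nodeSub e ≤ MulAut.conj γ' • X.vertSub v' ∧
        MulAut.conj γ • X.Iv v ≤ X.IvNode e ∧ MulAut.conj γ' • X.Iv v' ≤ X.IvNode e ∧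
        (MulAut.conj γ • X.Iv v ⊔ MulAut.conj γ' • X.Iv v').relIndex (X.IvNode e) ≠ 0)
    (hclaim : ∀ (v v' : X.Vert) (γ : X.PiH), v ≠ v' → ¬ X.Adjacent v v' → γ ∈ X.PiG →
      X.vertSub v ⊓ MulAut.conj γ • X.vertSub v' = ⊥) :
    Literature.AnabelianGeometry.AbsoluteAnabelian.DPSCData.Prop13iv_moreover X.toDPSCData := by
  refine X.toDPSCData.prop13iv_moreover_of_inputs hiv hbranch (fun e => (hii e).1.2.1)
    (fun v => (hiii v).2) (fun v => ?_) (fun e => ?_) (fun v => (hv v).2.2.2.1) hclaim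
  · -- `D_v ∩ Π_I = Z_{Π_I}(I_v)` ((v)′, computed inside `Π_I`) ⇒ `D_v ∩ Π_I ⊆ Z(I_v)`
    have h := (hv' v).2.2.1
    have hle : X.Iv v ≤ X.PiI := inf_le_right
    rw [centralizer_subgroupOf_eq hle, Subgroup.subgroupOf_inj] at h
    intro x hx
    have hx' : x ∈ X.Dv v ⊓ X.PiI ⊓ X.PiI := ⟨hx, hx.2⟩
    rw [h] at hx'
    exact hx'.1.1
  · -- `C_{Π_I}(Π_e) = C_{Π_H}(Π_e) ∩ Π_I = D_e ∩ Π_I = I_e` ((vii))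
    obtain ⟨h1, -, h3⟩ := hvii.1 e
    rw [h3, h1]

/-- **[AbsTopII] Prop 1.3 (viii) AS TYPED with the printed conjugacy scope**
(`DPSCIndexData.Prop_1_3_viii'`, abc-iut-L4-t6 p427207) **from its printed inputs**.  PROVED (group
theory, p. 16 l. 33–35): "if property (2) holds, then by assertions (ii), (iii), [for appropriate choices
of conjugates] `(Ẑ^Σ ≅) I_v ⊆ D_e ∩ D_{e′} ∩ Π_I ↪ I`, so `I_v = D_e ∩ D_{e′} ∩ Π_I`" — the EQUALITY of
the «Moreover» clause (`eq_conj_Iv_of_conj_Iv_le`: the `Π_𝔾`-part of `D_e ∩ γD_{e′}γ⁻¹ ∩ Π_I` vanishes in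
situation (2), and `I_v ↠ I`).  HYPOTHESES (printed inputs, verbatim): `hdich` = the DICHOTOMY (1)/(2)
(proof pp. 16–19, by log étale cyclic coverings — GEOMETRIC, "it suffices to verify that either (1) or
(2) holds"), carrying, under the SAME `∃ v`, the inclusion "`I_v ⊆ D_e ∩ D_{e′} ∩ Π_I` [for appropriate
choices of conjugates]" as a `Π_𝔾`-conjugate `hI_vh⁻¹`, `h ∈ Π_𝔾` (Def 1.2 (ii) p. 10); `hsurj` =
"`I_v ↠ I`" ((iii) proof p. 13).  Typed ≠ proved for the inputs.
[cite: MochizukiAbsTopII2013, Prop 1.3 (viii) p.12] -/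
theorem prop_1_3_viii'_of_inputs
    (hdich : ∀ (e e' : X.Edge) (γ : X.PiH), γ ∈ X.PiG →
      X.DEdge e ⊓ MulAut.conj γ • X.DEdge e' ⊓ X.PiI ≠ ⊥ →
      e = e' ∨
        (e ≠ e' ∧ ∃ v : X.Vert, X.EdgeAbuts e v ∧ X.EdgeAbuts e' v ∧
          X.DEdge e ⊓ MulAut.conj γ • X.DEdge e' ⊓ X.PiG = ⊥ ∧
          ∃ h : X.PiH, h ∈ X.PiG ∧
            MulAut.conj h • X.Iv v ≤ X.DEdge e ⊓ MulAut.conj γ • X.DEdge e' ⊓ X.PiI))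
    (hsurj : ∀ v : X.Vert, X.Iv v ⊔ X.PiG = X.PiI) :
    Literature.AnabelianGeometry.AbsoluteAnabelian.AbsTopII.DPSCIndexData.Prop_1_3_viii' X := by
  intro e e' γ hγ hne
  rcases hdich e e' γ hγ hne with h | ⟨hne', v, hv, hv', hbot, h, hh, hle⟩
  · exact Or.inl h
  · refine Or.inr ⟨hne', v, hv, hv', hbot, h, hh, ?_⟩
    symm
    refine X.toDPSCData.eq_conj_Iv_of_conj_Iv_le (hsurj v) hle inf_le_right ?_
    rw [inf_assoc, inf_eq_right.mpr X.PiG_le_PiI]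
    exact hbot

end AbsTopII.DPSCIndexData

end Literature.AnabelianGeometry.AbsoluteAnabelian
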